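import Literature.Dynamics.Tilings.TorusCNFBandClauses
import Literature.Computability.MetaComplexity.DepthFregeLocalRefutation
import HarnessLib

/-!
# Eliminating one column of the band: a decision tree as staged local steps (toolkit, II)

Topic `Literature/Dynamics/Tilings`. Continuation of `TorusCNFBandClauses.lean`. The basic move
of the dynamic-programming refutation of `torusCNF T n` over a band of rows `0, …, m`
(`TorusCNFBandRefutation.lean`) is COLUMN ELIMINATION: given a clause `Kp` (in the application:
"column `0` is not in state `σ₀` or column `c` is not in state `σ`") such that for EVERY state
`σ'` of column `d` the clause `Kp ∨ NS d σ'` contains an available clause (a clause of the CNF or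
one derived earlier), derive `Kp` itself. The derivation is the decision tree over the cells
`(m, d), (m-1, d), …, (0, d)` read bottom-up, written as STAGES of local steps
(`IsStaged`, `DepthFregeLocalRefutation.lean`):

* `stage Kp d r k` — the clauses `Kp ++ NSP d σ r ++ AL t d r k` for all states `σ` ("`Kp`, or
  the rows `< r` of column `d` differ from `σ`, or cell `(r, d)` carries a tile `≥ k`");
  `rowStages`, `elimStages` (rows `m, …, 0`, for each row `k = 0, …, t`);
* `isStaged_elimStages` — these stages are staged local steps with locality
  `|Kp| + (m + 1) + t`: `k = 0` from the at-least-one clause of the cell, `k + 1` from stage `k`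
  and the row-`(r+1)` clause of the state updated at `r` (a resolution step on `x_(r,d,k)`);
* `mem_elimStages` (`Kp` is derived: row `0`, `k = t`), `length_flatten_elimStages`
  (`(m+1)(t+1)t^(m+1)` clauses), `length_le_of_mem_elimStages`.

Elementary; [folklore] (the decision-tree / width-bounded resolution view of dynamic programming,
cf. Krajíček, *Proof complexity*, CUP 2019, §5.4).
-/

namespace Literature.Dynamics.Tilings

namespace TorusBand

open Literature.Computability.Complexity Literature.Computability.MetaComplexity WangTileSet

universe v

variable {C : Type v} [DecidableEq C] {t n m : ℕ}

/-! ### The stages -/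

variable (t) in
/-- One stage of the elimination of column `d`: for every state `σ`, the clause
`Kp ++ NSP d σ r ++ AL t d r k`. [folklore] -/
noncomputable def stage (hmn : m < n) (Kp : Clause ℕ) (d : Fin n) (r : Fin (m + 1)) (k : ℕ) :
    List (Clause ℕ) :=
  (states m t).map fun σ => Kp ++ NSP hmn d σ r.1 ++ AL t hmn d r k

variable (t) in
/-- The stages of one row: `k = 0, …, t`. [folklore] -/
noncomputable def rowStages (hmn : m < n) (Kp : Clause ℕ) (d : Fin n) (r : Fin (m + 1)) :
    List (List (Clause ℕ)) :=
  (List.range (t + 1)).map fun k => stage t hmn Kp d r k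

/-- The rows `i - 1, i - 2, …, 0` of the band, in this order. [folklore] -/
def rowsDesc (m : ℕ) : ℕ → List (Fin (m + 1))
  | 0 => []
  | i + 1 => if h : i < m + 1 then ⟨i, h⟩ :: rowsDesc m i else rowsDesc m i

variable (t) in
/-- **The elimination of column `d`**: the rows `m, …, 0`, for each the stages `k = 0, …, t`.
[folklore] -/
noncomputable def elimStages (hmn : m < n) (Kp : Clause ℕ) (d : Fin n) : List (List (Clause ℕ)) :=
  (rowsDesc m (m + 1)).flatMap fun r => rowStages t hmn Kp d r

/-- Every row `< i` (and `≤ m`) is listed in `rowsDesc m i`. [folklore] -/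
theorem mem_rowsDesc {i : ℕ} (r : Fin (m + 1)) (hr : r.1 < i) : r ∈ rowsDesc m i := by
  induction i with
  | zero => exact absurd hr (Nat.not_lt_zero _)
  | succ i ih =>
    show r ∈ (if h : i < m + 1 then ⟨i, h⟩ :: rowsDesc m i else rowsDesc m i)
    by_cases hi : i < m + 1
    · rw [dif_pos hi]
      rcases Nat.lt_succ_iff_lt_or_eq.1 hr with h | h
      · exact List.mem_cons_of_mem _ (ih h)
      · have : r = ⟨i, hi⟩ := Fin.ext h
        rw [this]; exact List.mem_cons_self
    · rw [dif_neg hi]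
      exact ih (lt_of_lt_of_le r.2 (not_lt.1 hi))

/-- `rowsDesc m i` has `min i (m+1)` members; in particular `m + 1` for `i = m + 1`. [folklore] -/
theorem length_rowsDesc_le (i : ℕ) : (rowsDesc m i).length ≤ i := by
  induction i with
  | zero => simp [rowsDesc]
  | succ i ih =>
    simp only [rowsDesc]
    split_ifs
    · simp only [List.length_cons]; omega
    · omega

/-! ### Membership and sizes -/

/-- Members of a stage. [folklore] -/
theorem mem_stage {hmn : m < n} {Kp : Clause ℕ} {d : Fin n} {r : Fin (m + 1)} {k : ℕ} {A : Clause ℕ} :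
    A ∈ stage t hmn Kp d r k ↔ ∃ σ : Fin (m + 1) → Fin t, A = Kp ++ NSP hmn d σ r.1 ++ AL t hmn d r k := by
  simp only [stage, List.mem_map]
  exact ⟨fun ⟨σ, _, h⟩ => ⟨σ, h.symm⟩, fun ⟨σ, h⟩ => ⟨σ, mem_states σ, h.symm⟩⟩

/-- Members of the elimination. [folklore] -/
theorem mem_flatten_elimStages {hmn : m < n} {Kp : Clause ℕ} {d : Fin n} {A : Clause ℕ} :
    A ∈ (elimStages t hmn Kp d).flatten ↔
      ∃ (r : Fin (m + 1)) (k : ℕ) (σ : Fin (m + 1) → Fin t), k ≤ t ∧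
        A = Kp ++ NSP hmn d σ r.1 ++ AL t hmn d r k := by
  simp only [elimStages, rowStages, List.mem_flatten, List.mem_flatMap, List.mem_map,
    List.mem_range]
  constructor
  · rintro ⟨S, ⟨r, -, k, hk, rfl⟩, hA⟩
    obtain ⟨σ, rfl⟩ := mem_stage.1 hA
    exact ⟨r, k, σ, Nat.le_of_lt_succ hk, rfl⟩
  · rintro ⟨r, k, σ, hk, rfl⟩
    exact ⟨_, ⟨r, mem_rowsDesc r r.2, k, Nat.lt_succ_of_le hk, rfl⟩, mem_stage.2 ⟨σ, rfl⟩⟩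

/-- **`Kp` is derived** (row `0`, `k = t`, any state; needs `t ≥ 1` for a state to exist).
[folklore] -/
theorem mem_elimStages {hmn : m < n} (ht : 0 < t) (Kp : Clause ℕ) (d : Fin n) :
    Kp ∈ (elimStages t hmn Kp d).flatten := by
  refine mem_flatten_elimStages.2 ⟨0, t, fun _ => ⟨0, ht⟩, le_rfl, ?_⟩
  rw [show ((0 : Fin (m + 1)) : ℕ) = 0 from rfl, NSP_zero, AL_of_le _ le_rfl]
  simp

/-- The prefix clauses of the rows are derived (`k = t`). [folklore] -/
theorem prefix_mem_elimStages {hmn : m < n} (Kp : Clause ℕ) (d : Fin n) (σ : Fin (m + 1) → Fin t)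
    (r : Fin (m + 1)) : Kp ++ NSP hmn d σ r.1 ∈ (elimStages t hmn Kp d).flatten := by
  refine mem_flatten_elimStages.2 ⟨r, t, σ, le_rfl, ?_⟩
  rw [AL_of_le _ le_rfl, List.append_nil]

/-- Lengths of the derived clauses. [folklore] -/
theorem length_le_of_mem_elimStages {hmn : m < n} {Kp : Clause ℕ} {d : Fin n} {A : Clause ℕ}
    (hA : A ∈ (elimStages t hmn Kp d).flatten) : A.length ≤ Kp.length + (m + 1) + t := by
  obtain ⟨r, k, σ, -, rfl⟩ := mem_flatten_elimStages.1 hA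
  simp only [List.length_append]
  have := length_NSP_le (hmn := hmn) d σ r.1
  have := length_AL_le (hmn := hmn) (t := t) d r k
  omega

/-- Length of a flattened `flatMap` with uniformly bounded pieces. [folklore] -/
theorem length_flatten_flatMap_le {α β : Type*} (L : List α) (f : α → List (List β)) (B : ℕ)
    (h : ∀ a ∈ L, (f a).flatten.length ≤ B) : (L.flatMap f).flatten.length ≤ L.length * B := by
  induction L with
  | nil => simp
  | cons a L ih =>
    rw [List.flatMap_cons, List.flatten_append, List.length_append, List.length_cons, Nat.succ_mul]
    have h1 := h a List.mem_cons_self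
    have h2 := ih fun a' ha' => h a' (List.mem_cons_of_mem _ ha')
    omega

/-- The number of derived clauses: `(m+1)(t+1)t^(m+1)` at most. [folklore] -/
theorem length_flatten_elimStages (hmn : m < n) (Kp : Clause ℕ) (d : Fin n) :
    (elimStages t hmn Kp d).flatten.length ≤ (m + 1) * ((t + 1) * t ^ (m + 1)) := by
  have hrow : ∀ r : Fin (m + 1), (rowStages t hmn Kp d r).flatten.length ≤ (t + 1) * t ^ (m + 1) := by
    intro r
    simp only [rowStages, List.length_flatten, List.map_map]
    have : ∀ k ∈ List.range (t + 1),
        (List.length ∘ fun k => stage t hmn Kp d r k) k = t ^ (m + 1) := fun k _ => by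
      simp [stage, length_states]
    rw [List.map_congr_left this]
    simp [List.sum_replicate, List.length_range]
  unfold elimStages
  exact (length_flatten_flatMap_le _ _ _ fun r _ => hrow r).trans
    (Nat.mul_le_mul_right _ (length_rowsDesc_le (m := m) (m + 1)))

/-! ### Availability and the variables of a step -/

/-- The clause `B` CONTAINS an available clause: a clause of `φ` or a member of `pre` all of whose
literals lie in `B`. [folklore] -/
def Avail (φ : CNF ℕ) (pre : List (Clause ℕ)) (B : Clause ℕ) : Prop :=
  ∃ A, (A ∈ φ ∨ A ∈ pre) ∧ ∀ l ∈ A, l ∈ B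

/-- Availability is monotone in the stock. [folklore] -/
theorem Avail.mono {φ : CNF ℕ} {pre pre' : List (Clause ℕ)} {B : Clause ℕ} (h : Avail φ pre B)
    (hsub : ∀ C ∈ pre, C ∈ pre') : Avail φ pre' B := by
  obtain ⟨A, hA, hAB⟩ := h
  exact ⟨A, hA.imp_right (hsub A), hAB⟩

/-- A member of the stock is available inside itself. [folklore] -/
theorem Avail.of_mem_pre {φ : CNF ℕ} {pre : List (Clause ℕ)} {B : Clause ℕ} (hB : B ∈ pre) :
    Avail φ pre B :=
  ⟨B, Or.inr hB, fun _ hl => hl⟩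

/-- A clause of `φ` contained in `B` makes `B` available. [folklore] -/
theorem Avail.of_mem {φ : CNF ℕ} {pre : List (Clause ℕ)} {A B : Clause ℕ} (hA : A ∈ φ)
    (hAB : ∀ l ∈ A, l ∈ B) : Avail φ pre B :=
  ⟨A, Or.inl hA, hAB⟩

/-- Availability inside a larger clause. [folklore] -/
theorem Avail.of_subset {φ : CNF ℕ} {pre : List (Clause ℕ)} {B B' : Clause ℕ} (h : Avail φ pre B)
    (hBB' : ∀ l ∈ B, l ∈ B') : Avail φ pre B' := by
  obtain ⟨A, hA, hAB⟩ := h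
  exact ⟨A, hA, fun l hl => hBB' l (hAB l hl)⟩

variable (t) in
/-- The variables of one elimination step at `(σ, r)` on column `d`: those of `Kp`, of the state
`σ` of column `d`, and all variables of the cell `(r, d)`. [folklore] -/
noncomputable def stepVars (hmn : m < n) (Kp : Clause ℕ) (d : Fin n) (σ : Fin (m + 1) → Fin t)
    (r : Fin (m + 1)) : List ℕ :=
  (Kp.map Prod.fst ++ (NS hmn d σ).map Prod.fst ++ (List.finRange t).map fun u => bv hmn d r u).dedup

/-- `stepVars` is duplicate free. [folklore] -/
theorem nodup_stepVars (hmn : m < n) (Kp : Clause ℕ) (d : Fin n) (σ : Fin (m + 1) → Fin t)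
    (r : Fin (m + 1)) : (stepVars t hmn Kp d σ r).Nodup :=
  List.nodup_dedup _

/-- `stepVars` has at most `|Kp| + (m+1) + t` members. [folklore] -/
theorem length_stepVars_le (hmn : m < n) (Kp : Clause ℕ) (d : Fin n) (σ : Fin (m + 1) → Fin t)
    (r : Fin (m + 1)) : (stepVars t hmn Kp d σ r).length ≤ Kp.length + (m + 1) + t := by
  unfold stepVars
  refine (List.Sublist.length_le (List.dedup_sublist _)).trans ?_
  simp only [List.length_append, List.length_map, length_NS, List.length_finRange]
  omega

/-- Variables of `Kp` are step variables. [folklore] -/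
theorem mem_stepVars_of_mem_Kp {hmn : m < n} {Kp : Clause ℕ} {d : Fin n} {σ : Fin (m + 1) → Fin t}
    {r : Fin (m + 1)} {l : Literal ℕ} (hl : l ∈ Kp) : l.1 ∈ stepVars t hmn Kp d σ r := by
  unfold stepVars
  rw [List.mem_dedup]
  exact List.mem_append_left _ (List.mem_append_left _ (List.mem_map.2 ⟨l, hl, rfl⟩))

/-- Variables of the state of column `d` are step variables. [folklore] -/
theorem bv_state_mem_stepVars {hmn : m < n} {Kp : Clause ℕ} {d : Fin n} {σ : Fin (m + 1) → Fin t}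
    {r : Fin (m + 1)} (r' : Fin (m + 1)) : bv hmn d r' (σ r') ∈ stepVars t hmn Kp d σ r := by
  unfold stepVars
  rw [List.mem_dedup]
  refine List.mem_append_left _ (List.mem_append_right _ (List.mem_map.2 ⟨_, mem_NS.2 ⟨r', rfl⟩, rfl⟩))

/-- Variables of the cell `(r, d)` are step variables. [folklore] -/
theorem bv_cell_mem_stepVars {hmn : m < n} {Kp : Clause ℕ} {d : Fin n} {σ : Fin (m + 1) → Fin t}
    {r : Fin (m + 1)} (u : Fin t) : bv hmn d r u ∈ stepVars t hmn Kp d σ r := by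
  unfold stepVars
  rw [List.mem_dedup]
  exact List.mem_append_right _ (List.mem_map.2 ⟨u, List.mem_finRange u, rfl⟩)

/-- Literals of a clause of the elimination at `(σ, r)` have step variables. [folklore] -/
theorem mem_stepVars_of_mem_clause {hmn : m < n} {Kp : Clause ℕ} {d : Fin n} {σ : Fin (m + 1) → Fin t}
    {r : Fin (m + 1)} {k : ℕ} {l : Literal ℕ} (hl : l ∈ Kp ++ NSP hmn d σ r.1 ++ AL t hmn d r k) :
    l.1 ∈ stepVars t hmn Kp d σ r := by
  rcases List.mem_append.1 hl with hl | hl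
  · rcases List.mem_append.1 hl with hl | hl
    · exact mem_stepVars_of_mem_Kp hl
    · obtain ⟨r', -, rfl⟩ := mem_NSP.1 hl
      exact bv_state_mem_stepVars r'
  · obtain ⟨u, -, rfl⟩ := mem_AL.1 hl
    exact bv_cell_mem_stepVars u

/-! ### The local steps -/

section Steps

variable (T : WangTileSet (Fin t) C)

/-- **Stage `0` of a row**: `Kp ++ NSP d σ r ++ AL t d r 0` follows from the at-least-one clause of
the cell `(r, d)`. [folklore] -/
theorem isLocalStep_zero (hmn : m < n) {N : ℕ} (Kp : Clause ℕ) (d : Fin n) (r : Fin (m + 1))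
    (σ : Fin (m + 1) → Fin t) (pre : List (Clause ℕ)) (hN : Kp.length + (m + 1) + t ≤ N) :
    IsLocalStep (T.torusCNF n) N pre (Kp ++ NSP hmn d σ r.1 ++ AL t hmn d r 0) := by
  obtain ⟨hmem, hiff⟩ := atLeastOne_mem T hmn d r
  refine ⟨_, _, stepVars t hmn Kp d σ r, Or.inl hmem, Or.inl hmem, nodup_stepVars hmn Kp d σ r,
    (length_stepVars_le hmn Kp d σ r).trans hN, ?_, ?_, fun l hl => mem_stepVars_of_mem_clause hl, ?_⟩
  · intro l hl
    obtain ⟨u, -, rfl⟩ := List.mem_map.1 hl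
    exact bv_cell_mem_stepVars u
  · intro l hl
    obtain ⟨u, -, rfl⟩ := List.mem_map.1 hl
    exact bv_cell_mem_stepVars u
  · intro τ h1 _
    rw [eval_append, Bool.or_eq_true]
    exact Or.inr (eval_of_subset (fun l hl => (hiff l).1 hl) h1)

/-- **Stage `k + 1` of a row**: `Kp ++ NSP d σ r ++ AL t d r (k+1)` follows from the stage-`k`
clause of `σ` and any clause available inside `Kp ++ NSP d σ' (r+1)` for the state `σ'` updated
at `r` to the tile `k` (resolution on the variable `x_(r,d,k)`). [folklore] -/
theorem isLocalStep_succ (hmn : m < n) {N : ℕ} (Kp : Clause ℕ) (d : Fin n) (r : Fin (m + 1))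
    (σ : Fin (m + 1) → Fin t) (pre : List (Clause ℕ)) (hN : Kp.length + (m + 1) + t ≤ N) {k : ℕ}
    (hk : k < t) (hprev : Kp ++ NSP hmn d σ r.1 ++ AL t hmn d r k ∈ pre)
    (hav : Avail (T.torusCNF n) pre (Kp ++ NSP hmn d (Function.update σ r ⟨k, hk⟩) (r.1 + 1))) :
    IsLocalStep (T.torusCNF n) N pre (Kp ++ NSP hmn d σ r.1 ++ AL t hmn d r (k + 1)) := by
  set σ' := Function.update σ r ⟨k, hk⟩ with hσ'
  obtain ⟨A, hA, hAB⟩ := hav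
  refine ⟨_, A, stepVars t hmn Kp d σ r, Or.inr hprev, hA, nodup_stepVars hmn Kp d σ r,
    (length_stepVars_le hmn Kp d σ r).trans hN, fun l hl => mem_stepVars_of_mem_clause hl, ?_,
    fun l hl => mem_stepVars_of_mem_clause hl, ?_⟩
  · -- variables of `A`
    intro l hl
    rcases List.mem_append.1 (hAB l hl) with h | h
    · exact mem_stepVars_of_mem_Kp h
    · obtain ⟨r', hr', rfl⟩ := mem_NSP.1 h
      by_cases hrr : r' = r
      · subst hrr
        simp only [hσ', Function.update_self]
        exact bv_cell_mem_stepVars _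
      · simp only [hσ', Function.update_of_ne hrr]
        exact bv_state_mem_stepVars r'
  · -- the resolution step, semantically
    intro τ h1 h2
    have hB := eval_of_subset hAB h2
    rw [eval_append, Bool.or_eq_true] at hB
    rw [eval_append, eval_append, Bool.or_eq_true, Bool.or_eq_true] at h1 ⊢
    rcases hB with hB | hB
    · exact Or.inl (Or.inl hB)
    · obtain ⟨r', hr', hfalse⟩ := (eval_NSP_eq_true_iff τ d σ' (r.1 + 1)).1 hB
      by_cases hrr : r' = r
      · subst hrr
        simp only [hσ', Function.update_self] at hfalse
        rcases h1 with h1 | h1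
        · exact Or.inl h1
        · obtain ⟨u, hku, hu⟩ := (eval_AL_eq_true_iff τ d r' k).1 h1
          refine Or.inr ((eval_AL_eq_true_iff τ d r' (k + 1)).2 ⟨u, ?_, hu⟩)
          have hne : u ≠ ⟨k, hk⟩ := fun h => by rw [h] at hu; rw [hu] at hfalse; exact Bool.noConfusion hfalse
          have : u.1 ≠ k := fun h => hne (Fin.ext h)
          omega
      · have hlt : r'.1 < r.1 := by
          have : r'.1 ≠ r.1 := fun h => hrr (Fin.ext h)
          omega
        simp only [hσ', Function.update_of_ne hrr] at hfalse
        exact Or.inl (Or.inr ((eval_NSP_eq_true_iff τ d σ r.1).2 ⟨r', hlt, hfalse⟩))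

/-- **The stages of one row are staged**, given availability of the row-`(r+1)` prefix clauses.
[folklore] -/
theorem isStaged_rowStages (hmn : m < n) {N : ℕ} (Kp : Clause ℕ) (d : Fin n) (r : Fin (m + 1))
    (pre : List (Clause ℕ)) (hN : Kp.length + (m + 1) + t ≤ N)
    (hav : ∀ σ : Fin (m + 1) → Fin t, Avail (T.torusCNF n) pre (Kp ++ NSP hmn d σ (r.1 + 1))) :
    IsStaged (T.torusCNF n) N pre (rowStages t hmn Kp d r) := by
  -- stages `j, …, t`, by downward induction on `j`
  have key : ∀ len j, j + len = t + 1 → ∀ pre' : List (Clause ℕ), (∀ C ∈ pre, C ∈ pre') →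
      (∀ k, k + 1 = j → ∀ σ : Fin (m + 1) → Fin t, Kp ++ NSP hmn d σ r.1 ++ AL t hmn d r k ∈ pre') →
      IsStaged (T.torusCNF n) N pre' ((List.range' j len).map fun k => stage t hmn Kp d r k) := by
    intro len
    induction len with
    | zero => intro j _ pre' _ _; simp [IsStaged]
    | succ len ih =>
      intro j hj pre' hpre hprev
      rw [List.range'_succ, List.map_cons, IsStaged.cons_iff]
      refine ⟨fun A hA => ?_, ih (j + 1) (by omega) _ (fun C hC => List.mem_append_left _ (hpre C hC)) ?_⟩
      · obtain ⟨σ, rfl⟩ := mem_stage.1 hA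
        rcases Nat.eq_zero_or_pos j with rfl | hj0
        · exact isLocalStep_zero T hmn Kp d r σ pre' hN
        · obtain ⟨k, rfl⟩ : ∃ k, j = k + 1 := ⟨j - 1, by omega⟩
          have hk : k < t := by omega
          exact isLocalStep_succ T hmn Kp d r σ pre' hN hk (hprev k rfl σ)
            ((hav (Function.update σ r ⟨k, hk⟩)).mono hpre)
      · intro k hk σ
        have hkj : k = j := by omega
        subst hkj
        exact List.mem_append_right _ (mem_stage.2 ⟨σ, rfl⟩)
  have h := key (t + 1) 0 (by omega) pre (fun C hC => hC) (fun k hk => absurd hk (by omega))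
  rw [rowStages, List.range_eq_range']
  exact h

end Steps

/-! ### The whole elimination -/

/-- `rowsDesc m (i+1)` for `i ≤ m`. [folklore] -/
theorem rowsDesc_succ {i : ℕ} (hi : i < m + 1) : rowsDesc m (i + 1) = ⟨i, hi⟩ :: rowsDesc m i := by
  simp [rowsDesc, hi]

/-- **Column elimination is staged**: if for every state `σ'` of column `d` the clause
`Kp ++ NS d σ'` contains an available clause, the stages `elimStages t hmn Kp d` are staged local
steps over the stock, with locality `|Kp| + (m+1) + t`; they derive `Kp` (`mem_elimStages`).
[folklore] -/
theorem isStaged_elimStages (T : WangTileSet (Fin t) C) (hmn : m < n) {N : ℕ} (Kp : Clause ℕ)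
    (d : Fin n) (pre : List (Clause ℕ)) (hN : Kp.length + (m + 1) + t ≤ N)
    (hav : ∀ σ : Fin (m + 1) → Fin t, Avail (T.torusCNF n) pre (Kp ++ NS hmn d σ)) :
    IsStaged (T.torusCNF n) N pre (elimStages t hmn Kp d) := by
  have key : ∀ i (hi : i ≤ m + 1) (pre' : List (Clause ℕ)), (∀ C ∈ pre, C ∈ pre') →
      (∀ σ : Fin (m + 1) → Fin t, Avail (T.torusCNF n) pre' (Kp ++ NSP hmn d σ i)) →
      IsStaged (T.torusCNF n) N pre' ((rowsDesc m i).flatMap fun r => rowStages t hmn Kp d r) := by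
    intro i
    induction i with
    | zero => intro _ pre' _ _; simp [rowsDesc, IsStaged]
    | succ i ih =>
      intro hi pre' hpre hav'
      rw [rowsDesc_succ (by omega), List.flatMap_cons, IsStaged.append_iff]
      refine ⟨isStaged_rowStages T hmn Kp d ⟨i, by omega⟩ pre' hN hav', ?_⟩
      refine ih (by omega) _ (fun C hC => List.mem_append_left _ (hpre C hC)) fun σ => ?_
      refine Avail.of_mem_pre (List.mem_append_right _ ?_)
      -- the prefix clause of row `i` is the `k = t` member of the row's stages
      simp only [rowStages, List.mem_flatten, List.mem_map, List.mem_range]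
      refine ⟨_, ⟨t, Nat.lt_succ_self t, rfl⟩, mem_stage.2 ⟨σ, ?_⟩⟩
      rw [AL_of_le _ le_rfl, List.append_nil]
  refine key (m + 1) le_rfl pre (fun C hC => hC) fun σ => ?_
  rw [NSP_of_le σ le_rfl]
  exact hav σ

end TorusBand

end Literature.Dynamics.Tilings
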